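import Summits.HodgeConjecture.HodgeConjecture.Theses.DerivedTorelliFermat
import Literature.AlgebraicGeometry.HodgeTheory.FermatDiagonalAction
import Literature.AlgebraicGeometry.HodgeTheory.AlgebraicClassesExteriorProduct
import Literature.AlgebraicGeometry.Motives.FermatHypersurface
import Literature.AlgebraicGeometry.Motives.SegreEmbedding

/-!
# Birth skeleton (BC3) of the crux `K3SectorAlgebraic` (stmt-HodgeConjecture-14577),
# route `DerivedTorelliFermat` — line `birth`: "move to `Sₘ × Sₘ`: type-I transfer, Hodge block, K3 engine"

The crux (rank 2, the route's thesis X): for every degree `m` and every Hodge character `α` of the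
Fermat fourfold `X⁴ₘ` in the REALISABLE K3 SECTOR — `α ∼ β # γ` with `β : Fin 4 → ℤ/m` admissible,
K3-TYPE (exactly one `tβ` with `Σ⟨tβᵢ⟩ = m`, i.e. `h²·⁰(V[β]) = 1`), of K3-realisable rank (unit
orbit `≤ 21`) and `β₃ + γ₃ = 0` — the eigenline `V(α) ⊂ H⁴(X⁴ₘ(ℂ); ℂ)` (spelled inline in the route
file as the simultaneous eigenspace of the diagonal symmetries) consists of algebraic classes.
Intended proof (route header, card derived-torelli-audits-fermat K1 + K2): `V(β # γ)` is the image
under Shioda's type-I correspondence `Sₘ × Sₘ ⇢ X⁴ₘ` of the Künneth line `V(β) ⊠ V(γ) ⊂ H⁴(Sₘ × Sₘ)`,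
which carries the ACCIDENTAL HODGE ISOMORPHISM `V[-β] ≅ V[γ]` between two K3-type CM pieces of
`H²(Sₘ, ℚ)`; realise both pieces algebraically as transcendental lattices of Delsarte / Fermat-
quotient CM K3 surfaces (Shioda 1986, Livné–Schütt–Yui 2010) and apply Buskin 2019 / Huybrechts
2019 (rational Hodge isometries of K3 surfaces are algebraic) once the multiplier is a norm.

The line cuts this proof at its three seams, all on the tree's REAL carriers (`complexBetti`,
`algebraicClasses = Nᵖ H²ᵖ`, `fermatEigenspace`, `diagonalAut`, the monoidal product `⊗` of
`SchemeOver ℂ`, `IsRationalClass`, `IsOfHodgeType`):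

  STUB 1 `stub_typeI_transfer` (Shioda 1979 Thm. I / da Silva Thm. 2.2; known in print, formalisation
    L–XL) — IF the pair eigenspace `W(β, γ) = V(β) ⊠ V(γ) ⊆ H⁴(Sₘ × Sₘ)` consists of algebraic
    classes THEN so does `V(α) ⊆ H⁴(X⁴ₘ)` for every Hodge `α ∼ β # γ` (`β, γ` admissible,
    `β₃ + γ₃ = 0`): `f = ψ_* π^*` along the blow-up of the base curve of
    `(x, y) ↦ (y₃x₀ : y₃x₁ : y₃x₂ : εx₃y₀ : εx₃y₁ : εx₃y₂)` preserves algebraic classes and maps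
    `W(β, γ)` isomorphically onto `V(β # γ)`.
  STUB 2 `stub_pairBlock_hodge` (Ran 1980 Prop. 1.7 / Shioda (1.7) + character theory; known, M–L) —
    for a HODGE PAIR (`Σ⟨tβᵢ⟩ + Σ⟨tγᵢ⟩ = 4m` for all units `t`) the line `W(β, γ)` lies in the
    `ℂ`-span of the RATIONAL `(2,2)`-classes of the Galois block `B(β, γ) = ⊕ₜ W(tβ, tγ)` (the block
    is `ℚ`-rational and entirely of type `(2,2)`).
  STUB 3 `stub_k3Engine_surfaceProduct` (THE HEART = the route's K3 engine; open, XL) — for `β`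
    admissible, K3-type, of K3-realisable rank, `γ` admissible, `β₃ + γ₃ = 0`, EVERY RATIONAL
    `(2,2)`-CLASS in the block `B(β, γ) ⊆ H⁴((Sₘ × Sₘ)(ℂ); ℂ)` IS ALGEBRAIC — the Hodge conjecture for
    the realisable-K3 blocks of `Sₘ × Sₘ`, i.e. the crux TRANSFERRED to the surface product, where
    `H²(Sₘ)`, its K3-type pieces and K3 surfaces are available (on `X⁴ₘ` there is no `H²` to work
    with), in honest HC-instance form. HC-safe (`heart_of_hodgeConjecture`, proved).

and the crux follows (`K3SectorAlgebraic_of`, kernel-checked, axioms propext/Classical.choice/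
Quot.sound, no `sorry`): given a Hodge `α` with a realisable-K3 split `β # γ`, `γ` is admissible and
the pair is Hodge (`gamma_ne_zero`, `gamma_sum_eq_zero`, `pairHodge_of_split` — PROVED residue
arithmetic: `Σ⟨tαᵢ⟩ = 3m` and `⟨tβ₃⟩ + ⟨-tβ₃⟩ = m`); STUB 2 puts `W(β, γ)` in the span of rational
`(2,2)` classes of the block, each algebraic by STUB 3 (`Submodule.span_le`); STUB 1 transfers
`W(β, γ) ⊆ alg` to `V(α) ⊆ alg`; and the crux's inline eigenvector predicate IS `c ∈ V(α)`
(`memPred_iff`, proved: `mem_fermatEigenspace_iff` + `fermatCharacter_apply`). The cut is tight and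
not a costume: STUB 1 is pure geometry of the inductive structure (no K3 / arithmetic content, does
not know `β` is K3-type); STUB 2 is pure Hodge theory of `Sₘ` (no algebraicity); STUB 3 alone says
nothing about `X⁴ₘ`. None is cheaply equivalent to the crux or the summit (BC3 probes, `Lines/birth.md`).

## Contents

* carriers: `fermatSurface m`, `fermatFourfold m` (standard models), `pairAut`, **`pairEigenspace m β γ`**
  (`W(β, γ)`, the simultaneous eigenspace of `μₘ⁴ × μₘ⁴` on `H⁴(Sₘ × Sₘ)` — Künneth-free), **`pairBlock`**
  (`B(β, γ) = ⊕ₜ W(tβ, tγ)`), `IsK3Type`, `HasK3Rank` (the crux's `∃!` / `∃ O` clauses verbatim);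
* PROVED: `memPred_iff` (inline predicate ↔ `fermatEigenspace`), `cupProduct_mem_pairEigenspace`
  (`pr₁^*x ∪ pr₂^*y ∈ W(β, γ)` for eigenvectors `x, y` — the carrier is the Künneth line, not junk),
  `cupProduct_mem_algebraicClasses_of_le` (the cycle-character case of type I is consistent:
  exterior products of algebraic classes are algebraic, tree theorem), `gamma_ne_zero`,
  `gamma_sum_eq_zero`, `pairHodge_of_split` (combinatorics of the split), `heart_of_hodgeConjecture`
  (HC ⟹ STUB 3), `k3Sector_hypothesis_inhabited` (BC5-style: at `m = 7`, `α₇ = (1,1,2,6,6,5) ∼ β₇ # γ₇`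
  with `β₇ = (1,1,2,3)` K3-type of orbit `6` satisfies the crux's hypothesis — `decide`);
* the three registered stubs (`sorry` ONLY there), `K3SectorAlgebraic_of` (stub₁ → stub₂ → stub₃ →
  the crux BY NAME) and `K3SectorAlgebraic_of_stubs`.

Disproof used: none on file — `Cruxes/K3SectorAlgebraic/` had no workfiles at registration
(`ledger crux ls stmt-HodgeConjecture-14577`: none; no `Disproof.lean`, no `_false_without_`, no
`Negative/`). Negatives index consulted: the route's own negative edge
`Theorems.DerivedTorelliFermatK3Exhaustion_refuted` (m = 110 exhaustion) concerns the RESIDUAL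
sector, which the rank-`≤ 21` clause (kept verbatim in STUB 3) excludes; no stub restates it.
Alternative line on record (not this skeleton): idea-node g10 "lattice-trivial-k3-sector" (evidence
on the item) — realisable-K3 sextuples are Shioda–Aoki reachable at their own level except the
`m = 33` family, which is STABLY reachable at level `66` (sibling crux `HodgeFermatVarieties`, landed
`CancelByAnyClaimLattice.D33`); that line replaces STUB 3 by level-raising + the printed supply.
-/

set_option linter.dupNamespace false

noncomputable section

namespace Summit.HodgeConjecture.HodgeConjecture.Cruxes.K3SectorAlgebraic.Birth

open CategoryTheory MonoidalCategory CartesianMonoidalCategory Finset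
open Literature.AlgebraicGeometry.Motives Literature.AlgebraicGeometry.HodgeTheory
open Literature.AlgebraicTopology.SingularHomology
open Summit.HodgeConjecture.HodgeConjecture.Theses.DerivedTorelliFermat (K3SectorAlgebraic)

/-! ### Carriers -/

/-- The Fermat surface `Sₘ = X²ₘ`, standard model `V₊(x₀ᵐ + x₁ᵐ + x₂ᵐ + x₃ᵐ) ⊂ ℙ³_ℂ`. [folklore] -/
abbrev fermatSurface (m : ℕ) : SchemeOver ℂ :=
  SmoothHypersurface.hypersurface (fermatPolynomial ℂ 2 m)

/-- The Fermat fourfold `X⁴ₘ`, standard model `V₊(Σᵢ₌₀⁵ xᵢᵐ) ⊂ ℙ⁵_ℂ` (the carrier of the crux). [folklore] -/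
abbrev fermatFourfold (m : ℕ) : SchemeOver ℂ :=
  SmoothHypersurface.hypersurface (fermatPolynomial ℂ (2 * 2) m)

variable (m : ℕ)

/-- The algebraic automorphism `g_a × g_b` of `Sₘ × Sₘ` for `a, b ∈ μₘ⁴`. [folklore] -/
abbrev pairAut (a b : fermatGroup 2 m) :
    fermatSurface m ⊗ fermatSurface m ⟶ fermatSurface m ⊗ fermatSurface m :=
  diagonalAut (fermatPolynomial ℂ 2 m) (fermatGroup_le_diagonalStabilizer m a.2) ⊗ₘ
    diagonalAut (fermatPolynomial ℂ 2 m) (fermatGroup_le_diagonalStabilizer m b.2)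

/-- **The pair eigenspace `W(β, γ) ⊆ H⁴((Sₘ × Sₘ)(ℂ); ℂ)`**: the simultaneous eigenspace of
`μₘ⁴ × μₘ⁴` acting on `Sₘ × Sₘ` by `g_a × g_b`, for the character `(a, b) ↦ χ_β(a) χ_γ(b)`. For
admissible `β, γ` (all entries non-zero, sum zero) this is the Künneth line `V(β) ⊠ V(γ)`
(`H¹ = H³ = 0` for the surface and `H⁰, H⁴` carry the trivial character), the source of Shioda's
type-I map `V(β) ⊗ V(γ) → V(β # γ)`. [cite: Shioda1979HodgeFermat, Thm. I] -/
def pairEigenspace (β γ : Fin 4 → ZMod m) :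
    Submodule ℂ (complexBetti (fermatSurface m ⊗ fermatSurface m) (2 * 2)) where
  carrier := {c | ∀ a b : fermatGroup 2 m,
    complexBetti.map (pairAut m a b) (2 * 2) c =
      (((fermatCharacter m β a * fermatCharacter m γ b : ℂˣ)) : ℂ) • c}
  add_mem' {x y} hx hy a b := by
    simp only [Set.mem_setOf_eq] at hx hy ⊢
    rw [map_add, hx a b, hy a b, smul_add]
  zero_mem' a b := by simp
  smul_mem' r {x} hx a b := by
    simp only [Set.mem_setOf_eq] at hx ⊢
    rw [map_smul, hx a b, smul_comm]

variable {m}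

/-- Membership in `W(β, γ)`, unfolded. [folklore] -/
theorem mem_pairEigenspace_iff {β γ : Fin 4 → ZMod m}
    {c : complexBetti (fermatSurface m ⊗ fermatSurface m) (2 * 2)} :
    c ∈ pairEigenspace m β γ ↔ ∀ a b : fermatGroup 2 m,
      complexBetti.map (pairAut m a b) (2 * 2) c =
        (((fermatCharacter m β a * fermatCharacter m γ b : ℂˣ)) : ℂ) • c :=
  Iff.rfl

/-- The **Galois block** `B(β, γ) = ⊕ₜ W(tβ, tγ) ⊆ H⁴((Sₘ × Sₘ)(ℂ); ℂ)`, `t` over the units of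
`ℤ/m`: the complexification of the `ℚ`-sub-Hodge structure `(V[β] ⊗ V[γ])^{diag}` of
`H⁴(Sₘ × Sₘ, ℚ)` cut out by the Galois orbit of the character `(β, γ)`. [cite: Shioda1979HodgeFermat, §1] -/
def pairBlock (m : ℕ) (β γ : Fin 4 → ZMod m) :
    Submodule ℂ (complexBetti (fermatSurface m ⊗ fermatSurface m) (2 * 2)) :=
  ⨆ t : (ZMod m)ˣ, pairEigenspace m (fun i ↦ (t : ZMod m) * β i) (fun i ↦ (t : ZMod m) * γ i)

/-- `W(β, γ) ⊆ B(β, γ)` (`t = 1`). [folklore] -/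
theorem pairEigenspace_le_pairBlock (β γ : Fin 4 → ZMod m) :
    pairEigenspace m β γ ≤ pairBlock m β γ := by
  intro c hc
  refine Submodule.mem_iSup_of_mem (1 : (ZMod m)ˣ) ?_
  simpa using hc

/-- **Exterior products of eigenvectors lie in the pair eigenspace**: for `x ∈ V(β)`, `y ∈ V(γ)`,
`pr₁^* x ∪ pr₂^* y ∈ W(β, γ)` — `(g_a × g_b)^*(pr₁^*x ∪ pr₂^*y) = pr₁^*(g_a^*x) ∪ pr₂^*(g_b^*y)`
(naturality of `∪`, `(g_a × g_b) ≫ prᵢ = prᵢ ≫ g`). So `W(β, γ) ⊇ V(β) ⊠ V(γ)` and the carrier is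
not vacuous. [cite: HatcherAT2002, §3.2 Prop. 3.10] -/
theorem cupProduct_mem_pairEigenspace {β γ : Fin 4 → ZMod m} {x y : complexBetti (fermatSurface m) (2 * 1)}
    (hx : x ∈ fermatEigenspace m β (2 * 1)) (hy : y ∈ fermatEigenspace m γ (2 * 1)) :
    cupProduct (two_mul_add_two_mul 1 1) (complexBetti.map (fst _ _) (2 * 1) x)
      (complexBetti.map (snd _ _) (2 * 1) y) ∈ pairEigenspace m β γ := by
  rw [mem_pairEigenspace_iff]
  intro a b
  rw [mem_fermatEigenspace_iff] at hx hy
  have h1 : complexBetti.map (pairAut m a b) (2 * 1) (complexBetti.map (fst _ _) (2 * 1) x) =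
      ((fermatCharacter m β a : ℂˣ) : ℂ) • complexBetti.map (fst _ _) (2 * 1) x := by
    rw [← CategoryTheory.comp_apply, ← complexBetti.map_comp, tensorHom_fst, complexBetti.map_comp,
      CategoryTheory.comp_apply,
      show complexBetti.map (diagonalAut (fermatPolynomial ℂ 2 m)
        (fermatGroup_le_diagonalStabilizer m a.2)) (2 * 1) x = _ from hx a, map_smul]
  have h2 : complexBetti.map (pairAut m a b) (2 * 1) (complexBetti.map (snd _ _) (2 * 1) y) =
      ((fermatCharacter m γ b : ℂˣ) : ℂ) • complexBetti.map (snd _ _) (2 * 1) y := by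
    rw [← CategoryTheory.comp_apply, ← complexBetti.map_comp, tensorHom_snd, complexBetti.map_comp,
      CategoryTheory.comp_apply,
      show complexBetti.map (diagonalAut (fermatPolynomial ℂ 2 m)
        (fermatGroup_le_diagonalStabilizer m b.2)) (2 * 1) y = _ from hy b, map_smul]
  rw [complexBetti.map, cupProduct_map, ← complexBetti.map, h1, h2, map_smul, map_smul,
    LinearMap.smul_apply, smul_smul, Units.val_mul]
  congr 1
  exact mul_comm _ _

/-- The Fermat surface `Sₘ` is smooth projective of dimension `2` (`m ≥ 1`; Jacobian criterion in
characteristic `0`). [cite: Hartshorne1977, I Ex. 5.9 / II Thm. 8.15] -/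
theorem isSmoothProjective_fermatSurface (m : ℕ) [NeZero m] : IsSmoothProjective 2 (fermatSurface m) :=
  SmoothHypersurface.isSmoothProjective_hypersurface_fermatPolynomial_of_charZero (by norm_num)
    NeZero.one_le

/-- `Sₘ × Sₘ` is smooth projective of dimension `4` (Segre). [cite: Hartshorne1977, III Prop. 10.1 (d), II Ex. 4.9] -/
theorem isSmoothProjective_surfaceProduct (m : ℕ) [NeZero m] :
    IsSmoothProjective 4 (fermatSurface m ⊗ fermatSurface m) :=
  IsSmoothProjective.tensor_holds (isSmoothProjective_fermatSurface m) (isSmoothProjective_fermatSurface m)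

/-- **Consistency with the cycle-character case** (`IsShiodaClosed.hash`, da Silva Cor. 2.3 (b)): if
`V(β)` and `V(γ)` consist of algebraic (divisor) classes of `Sₘ`, the exterior products
`pr₁^*x ∪ pr₂^*y`, `x ∈ V(β)`, `y ∈ V(γ)`, are algebraic on `Sₘ × Sₘ` (tree:
`cupProduct_map_fst_map_snd_mem_algebraicClasses`). In the crux `β`, `γ` are NOT Hodge characters of
`Sₘ`, which is why STUB 3 is needed. [cite: VoisinHodgeII2003, proof of Prop. 9.20] -/
theorem cupProduct_mem_algebraicClasses_of_le [NeZero m] {β γ : Fin 4 → ZMod m}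
    (hβ : fermatEigenspace m β (2 * 1) ≤ algebraicClasses (fermatSurface m) 1)
    (hγ : fermatEigenspace m γ (2 * 1) ≤ algebraicClasses (fermatSurface m) 1)
    {x y : complexBetti (fermatSurface m) (2 * 1)}
    (hx : x ∈ fermatEigenspace m β (2 * 1)) (hy : y ∈ fermatEigenspace m γ (2 * 1)) :
    cupProduct (two_mul_add_two_mul 1 1) (complexBetti.map (fst _ _) (2 * 1) x)
      (complexBetti.map (snd _ _) (2 * 1) y) ∈ algebraicClasses (fermatSurface m ⊗ fermatSurface m) (1 + 1) :=
  cupProduct_map_fst_map_snd_mem_algebraicClasses (isSmoothProjective_fermatSurface m)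
    (isSmoothProjective_fermatSurface m) (hβ hx) (hγ hy)

/-! ### The crux's inline spellings, named -/

/-- `β` is a **K3-type** character of the Fermat surface: exactly one `δ = tβ` in its unit orbit has
`Σ⟨δᵢ⟩ = m` (i.e. `h²·⁰(V[β]) = 1`) — the crux's `∃!` clause verbatim. [cite: Shioda1979HodgeFermat, §1] -/
def IsK3Type (β : Fin 4 → ZMod m) : Prop :=
  ∃! δ : Fin 4 → ZMod m, (∃ t : (ZMod m)ˣ, δ = fun i => (t : ZMod m) * β i) ∧
    FermatCharacter.normSum δ = m

/-- `β` has **K3-realisable rank**: its unit orbit has at most `21` elements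
(`rank V[β] = φ(d′) ≤ 21`, the maximal rank of the transcendental lattice of a projective K3
surface) — the crux's `∃ O` clause verbatim. [cite: Huybrechts2016K3, Ch. 3 §3] -/
def HasK3Rank (β : Fin 4 → ZMod m) : Prop :=
  ∃ O : Finset (Fin 4 → ZMod m), O.card ≤ 21 ∧ ∀ t : (ZMod m)ˣ, (fun i => (t : ZMod m) * β i) ∈ O

/-- **Bridge**: the crux's inline eigenvector predicate on `H⁴(X⁴ₘ(ℂ); ℂ)` IS membership in
Shioda's `V(α) = fermatEigenspace m α 4` (`mem_fermatEigenspace_iff` + `fermatCharacter_apply`;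
the planner's rev-5 certificate `memPred_iff`, re-proved here). [cite: Shioda1979PJA, §4] -/
theorem memPred_iff [NeZero m] {α : Fin (2 * 2 + 2) → ZMod m} {c : complexBetti (fermatFourfold m) (2 * 2)} :
    (∀ (a : Fin (2 * 2 + 2) → ℂˣ) (ha : a ∈ diagonalStabilizer (fermatPolynomial ℂ (2 * 2) m)),
        (∀ i, a i ^ m = 1) →
          singularCohomology.map ℂ ℂ (diagonalMap (fermatPolynomial ℂ (2 * 2) m) ha) (2 * 2) c =
            (∏ i, (a i : ℂ) ^ (α i).val) • c) ↔
      c ∈ fermatEigenspace m α (2 * 2) := by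
  rw [mem_fermatEigenspace_iff]
  constructor
  · intro h a
    rw [h a.1 (fermatGroup_le_diagonalStabilizer m a.2) (mem_fermatGroup_iff.mp a.2),
      fermatCharacter_apply]
    push_cast
    rfl
  · intro h a ha hm
    have := h ⟨a, mem_fermatGroup_iff.mpr hm⟩
    rw [fermatCharacter_apply] at this
    push_cast at this
    exact this

/-! ### Combinatorics of the K3 split (proved): `γ` is admissible and the pair `(β, γ)` is Hodge -/

section Split

variable [NeZero m] {α : Fin (2 * 2 + 2) → ZMod m} {β γ : Fin 4 → ZMod m}

omit [NeZero m] in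
/-- In a split `α ∼ β # γ` of a Hodge character with `β` admissible, every `γⱼ ≠ 0`. [folklore] -/
theorem gamma_ne_zero (hα : FermatCharacter.IsHodge α) (hβ0 : ∀ i, β i ≠ 0) (h3 : β 3 + γ 3 = 0)
    (hsplit : univ.val.map α = ({β 0, β 1, β 2} + {γ 0, γ 1, γ 2} : Multiset (ZMod m))) :
    ∀ j, γ j ≠ 0 := by
  have hmem : ∀ x ∈ ({γ 0, γ 1, γ 2} : Multiset (ZMod m)), x ≠ 0 := by
    intro x hx
    have hx' : x ∈ univ.val.map α := by
      rw [hsplit]; exact Multiset.mem_add.mpr (Or.inr hx)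
    obtain ⟨i, -, rfl⟩ := Multiset.mem_map.mp hx'
    exact hα.1.1 i
  have hγ3 : γ 3 = -β 3 := eq_neg_of_add_eq_zero_right h3
  intro j
  fin_cases j
  · exact hmem _ (by simp)
  · exact hmem _ (by simp)
  · exact hmem _ (by simp)
  · simpa [hγ3] using hβ0 3

omit [NeZero m] in
/-- In a split `α ∼ β # γ` of a Hodge character with `β` admissible, `Σ γⱼ = 0`. [folklore] -/
theorem gamma_sum_eq_zero (hα : FermatCharacter.IsHodge α) (hβs : ∑ i, β i = 0) (h3 : β 3 + γ 3 = 0)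
    (hsplit : univ.val.map α = ({β 0, β 1, β 2} + {γ 0, γ 1, γ 2} : Multiset (ZMod m))) :
    ∑ j, γ j = 0 := by
  have hαs : ∑ i, α i = 0 := hα.1.2
  rw [Finset.sum_eq_multiset_sum, hsplit] at hαs
  simp only [Multiset.sum_add, Multiset.insert_eq_cons, Multiset.sum_cons, Multiset.sum_singleton] at hαs
  rw [Fin.sum_univ_four] at hβs ⊢
  linear_combination hαs - hβs + h3

/-- **The pair `(β, γ)` of a K3 split is Hodge**: `Σ⟨tβᵢ⟩ + Σ⟨tγᵢ⟩ = 4m` for every unit `t`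
(so `V(tβ) ⊠ V(tγ)` is of type `(2,2)` for all `t`: when `V(tβ)` is `(2,0)`, `V(tγ)` is `(0,2)`, etc.).
From `2Σ⟨tαᵢ⟩ = 6m` and `⟨tβ₃⟩ + ⟨tγ₃⟩ = ⟨tβ₃⟩ + ⟨-tβ₃⟩ = m`. [cite: Shioda1979HodgeFermat, §1] -/
theorem pairHodge_of_split (hα : FermatCharacter.IsHodge α) (hβ0 : ∀ i, β i ≠ 0) (h3 : β 3 + γ 3 = 0)
    (hsplit : univ.val.map α = ({β 0, β 1, β 2} + {γ 0, γ 1, γ 2} : Multiset (ZMod m)))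
    (t : (ZMod m)ˣ) :
    FermatCharacter.normSum (fun i ↦ (t : ZMod m) * β i) +
      FermatCharacter.normSum (fun i ↦ (t : ZMod m) * γ i) = m * 4 := by
  have hαt := hα.2 t
  have hγ3 : γ 3 = -β 3 := eq_neg_of_add_eq_zero_right h3
  have htβ3 : (t : ZMod m) * β 3 ≠ 0 := (Units.mul_right_eq_zero t).not.mpr (hβ0 3)
  have hpair : ((t : ZMod m) * β 3).val + ((t : ZMod m) * γ 3).val = m := by
    rw [hγ3, mul_neg]; exact FermatCharacter.val_add_val_neg htβ3
  have hmap : univ.val.map (fun i ↦ (t : ZMod m) * α i) =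
      ({(t : ZMod m) * β 0, (t : ZMod m) * β 1, (t : ZMod m) * β 2} +
        {(t : ZMod m) * γ 0, (t : ZMod m) * γ 1, (t : ZMod m) * γ 2} : Multiset (ZMod m)) := by
    have : univ.val.map (fun i ↦ (t : ZMod m) * α i) =
        (univ.val.map α).map (fun a ↦ (t : ZMod m) * a) := by
      rw [Multiset.map_map]; rfl
    rw [this, hsplit]
    simp [Multiset.insert_eq_cons]
  have hαsum : FermatCharacter.normSum (fun i ↦ (t : ZMod m) * α i) =
      (((t : ZMod m) * β 0).val + (((t : ZMod m) * β 1).val + ((t : ZMod m) * β 2).val)) +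
      (((t : ZMod m) * γ 0).val + (((t : ZMod m) * γ 1).val + ((t : ZMod m) * γ 2).val)) := by
    rw [FermatCharacter.normSum_eq_mNormSum, hmap, FermatCharacter.mNormSum_add]
    simp [FermatCharacter.mNormSum, Multiset.insert_eq_cons]
  rw [hαsum] at hαt
  unfold FermatCharacter.normSum
  rw [Fin.sum_univ_four, Fin.sum_univ_four]
  beta_reduce
  omega

end Split

/-! ### The three registered stubs -/

/-- STUB 1 (known in print; formalisation L–XL — Shioda's blow-up/`μₘ`-quotient correspondence is
not in the tree) — **Shioda's type-I transfer `Sₘ × Sₘ ⇢ X⁴ₘ` on eigenlines**: for admissible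
characters `β, γ` of the Fermat surface with `β₃ + γ₃ = 0` and a Hodge character `α ∼ β # γ` of
`X⁴ₘ` (equality of multisets `{αᵢ} = {β₀,β₁,β₂} + {γ₀,γ₁,γ₂}`), IF the pair eigenspace
`W(β, γ) = V(β) ⊠ V(γ) ⊆ H⁴(Sₘ × Sₘ)` consists of algebraic classes THEN so does `V(α) ⊆ H⁴(X⁴ₘ)`.
Shioda, Math. Ann. 245 (1979) Thm. I / da Silva Thm. 2.2: `f = ψ_* ∘ π^*` (blow up the base locus
`x₃ = 0 = y₃` of `(x, y) ↦ (y₃x₀ : y₃x₁ : y₃x₂ : εx₃y₀ : εx₃y₁ : εx₃y₂)`, `εᵐ = -1`) is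
`G`-equivariant, maps `[V(β) ⊗ V(γ)]^{μₘ}` (non-zero iff `β₃ + γ₃ = 0`) isomorphically onto
`V(β # γ)` and "preserves algebraic cycles" (Thm. 2.2 (c)); `dim V(α) = 1` for admissible `α`
(Thm. 2.1 (a)) and claim is invariant under permuting coordinates (tree:
`FermatCharacter.Claim.of_univ_val_map_eq`). Only the case "both `β`, `γ` cycle characters"
(`IsShiodaClosed.hash`) is spelled in the tree; here `β`, `γ` are NOT Hodge characters of `Sₘ`.
Why it might fail: it does not in print; on the tree it needs the blow-up of `Sₘ × Sₘ` along a
curve, proper push-forward / pull-back of `algebraicClasses` along the correspondence (flat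
pull-back and Gysin push-forward exist: `FermatJuxtapositionGysin`), and the eigenspace isomorphism.
[cite: Shioda1979HodgeFermat, Thm. I] [cite: daSilva2021HodgeFermat, Thm. 2.2 (a)–(c), Cor. 2.3 (b)]
[cite: ShiodaKatsura1979, §1 Thm. 1.7] -/
theorem stub_typeI_transfer :
    ∀ (m : ℕ) [NeZero m] (β γ : Fin 4 → ZMod m) (α : Fin (2 * 2 + 2) → ZMod m),
      (∀ i, β i ≠ 0) → ∑ i, β i = 0 → (∀ j, γ j ≠ 0) → ∑ j, γ j = 0 → β 3 + γ 3 = 0 →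
      FermatCharacter.IsHodge α →
      univ.val.map α = ({β 0, β 1, β 2} + {γ 0, γ 1, γ 2} : Multiset (ZMod m)) →
      pairEigenspace m β γ ≤ algebraicClasses (fermatSurface m ⊗ fermatSurface m) 2 →
      fermatEigenspace m α (2 * 2) ≤ algebraicClasses (fermatFourfold m) 2 := by
  sorry

/-- STUB 2 (known Hodge theory of Fermat surfaces; formalisation M–L) — **the Galois block of a Hodge
pair is spanned by rational `(2,2)`-classes**: for admissible `β, γ` with
`Σ⟨tβᵢ⟩ + Σ⟨tγᵢ⟩ = 4m` for all units `t`, the eigenline `W(β, γ)` lies in the `ℂ`-span of the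
RATIONAL classes of Hodge type `(2,2)` contained in the block `B(β, γ) = ⊕ₜ W(tβ, tγ)`. Proof in
print: `B` is the sum of the eigenspaces over a Galois orbit of characters of the `ℚ`-rational
action of `μₘ⁴ × μₘ⁴` by automorphisms, hence `B = B_ℚ ⊗ ℂ` (the block projector
`Σₜ π_{(tβ,tγ)}` is `ℚ`-rational: character orthogonality, as in the tree's `eigenProjector` /
`isRationalClass_eigenProjector_add`); `V(δ) ⊂ H^{p,q}(Sₘ)` with `p = Σ⟨δᵢ⟩/m - 1` (Ran Prop. 1.7,
Shioda (1.7); Griffiths residues) and Hodge types multiply under Künneth (tree: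
`isOfHodgeType_cupProduct_map_fst_map_snd_…`), so the pair condition makes every `W(tβ, tγ)`, hence
`B_ℚ`, of type `(2,2)`; thus `W(β,γ) ⊆ B = span_ℂ (B_ℚ) ⊆ span_ℂ {rational (2,2) classes in B}`.
Why it might fail: it does not in print; on the tree the Hodge types of the surface eigenlines
`V(δ)` (the `(p,q)`-refinement of the route's support `EigenspaceInputs`) and the rationality of
Galois-block projectors for `μₘ⁴ × μₘ⁴` on a PRODUCT are unproved (the tree has them for one
factor and orders dividing `4`, `6` only).
[cite: Ran1980, §1 Prop. 1.7] [cite: Shioda1979HodgeFermat, §1 (1.7)] [cite: Katz2009, §3] -/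
theorem stub_pairBlock_hodge :
    ∀ (m : ℕ) [NeZero m] (β γ : Fin 4 → ZMod m),
      (∀ i, β i ≠ 0) → ∑ i, β i = 0 → (∀ j, γ j ≠ 0) → ∑ j, γ j = 0 →
      (∀ t : (ZMod m)ˣ, FermatCharacter.normSum (fun i ↦ (t : ZMod m) * β i) +
        FermatCharacter.normSum (fun i ↦ (t : ZMod m) * γ i) = m * 4) →
      pairEigenspace m β γ ≤ Submodule.span ℂ
        {c | IsRationalClass c ∧ IsOfHodgeType 4 (fermatSurface m ⊗ fermatSurface m) (2 * 2) 2 2 c ∧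
          c ∈ pairBlock m β γ} := by
  sorry

/-- STUB 3 (THE HEART — the route's K3 engine, card K1 + K2; open, XL) — **the Hodge conjecture for
the realisable-K3 blocks of `H⁴(Sₘ × Sₘ)`**: for `β` admissible, K3-TYPE (exactly one `tβ` with
`Σ⟨tβᵢ⟩ = m`, i.e. `h²·⁰(V[β]) = 1`) of K3-REALISABLE RANK (unit orbit `≤ 21`), `γ` admissible with
`β₃ + γ₃ = 0`, every RATIONAL class of Hodge type `(2,2)` in the Galois block
`B(β, γ) ⊆ H⁴((Sₘ × Sₘ)(ℂ); ℂ)` is algebraic. These Hodge classes are exactly the (accidental) Hodge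
morphisms `V[-β] → V[γ]` between CM pieces of `H²(Sₘ, ℚ)`; intended proof: realise `V[β]_ℚ ≅ T(Y_β)_ℚ`
ALGEBRAICALLY for a Delsarte / Fermat-quotient CM K3 surface `Y_β` (Shioda 1986; Livné–Schütt–Yui
2010, `X₆₆` for order `33`), likewise the partner, and show the resulting Hodge similitude
`T(Y_β)_ℚ → T(Y_γ)_ℚ` has NORM multiplier, hence is a rescaled Hodge ISOMETRY, algebraic by
Buskin 2019 Thm. 1.1 / Huybrechts 2019 Rem. 3.3 (tree named fact
`Surfaces.Buskin2019_hodgeIsometry_algebraic`); compose the correspondences `Sₘ ⊢ Y_β ⊢ Y_γ ⊢ Sₘ`.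
This is the crux MOVED to the surface product, where `H²` and K3 surfaces are available (Transfer),
in honest HC-instance form (rational `(2,2)` ⟹ algebraic); HC-safe (`heart_of_hodgeConjecture`).
Why it might fail: a Delsarte K3 realises ONE character orbit (LSY 2010 Rem. 4) and the partner
orbit may have no algebraic K3 realisation; the multiplier may be a non-norm (no isometry — only the
Kuga–Satake-conditional Varesco Thm. 5.3); and when `h²·⁰(V[γ]) ≥ 2` (allowed by the typed clause,
which constrains only `β`) `V[γ] ⊇` a K3-type image not cut out by characters.
[cite: Buskin2019, Thm. 1.1] [cite: Huybrechts2019, Thm. 0.2, Rem. 3.3] [cite: Shioda1986, §3]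
[cite: LivneSchuttYui2010, Thm. 1–2, Rem. 4] [cite: Mukai1987ModuliBundlesK3, Thm. 1.10] [cite: Varesco2023, Thm. 5.3] -/
theorem stub_k3Engine_surfaceProduct :
    ∀ (m : ℕ) [NeZero m] (β γ : Fin 4 → ZMod m),
      (∀ i, β i ≠ 0) → ∑ i, β i = 0 → IsK3Type β → HasK3Rank β →
      (∀ j, γ j ≠ 0) → ∑ j, γ j = 0 → β 3 + γ 3 = 0 →
      ∀ c ∈ pairBlock m β γ, IsRationalClass c →
        IsOfHodgeType 4 (fermatSurface m ⊗ fermatSurface m) (2 * 2) 2 2 c →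
        c ∈ algebraicClasses (fermatSurface m ⊗ fermatSurface m) 2 := by
  sorry

/-! ### Proved sanity: HC-safety of the heart, and the sector is inhabited in kind -/

/-- **HC-safety of the heart (PROVED)**: the Hodge conjecture (for the smooth projective fourfold
`Sₘ × Sₘ`) implies STUB 3 — it is an honest instance family of HC, so it cannot be refuted short of a
counterexample to the summit; the risk of the line is hardness, concentrated there. [cite: Deligne2000, §1] -/
theorem heart_of_hodgeConjecture (hHC : _root_.HodgeConjecture) :
    ∀ (m : ℕ) [NeZero m] (β γ : Fin 4 → ZMod m),
      (∀ i, β i ≠ 0) → ∑ i, β i = 0 → IsK3Type β → HasK3Rank β →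
      (∀ j, γ j ≠ 0) → ∑ j, γ j = 0 → β 3 + γ 3 = 0 →
      ∀ c ∈ pairBlock m β γ, IsRationalClass c →
        IsOfHodgeType 4 (fermatSurface m ⊗ fermatSurface m) (2 * 2) 2 2 c →
        c ∈ algebraicClasses (fermatSurface m ⊗ fermatSurface m) 2 :=
  fun m _ _ _ _ _ _ _ _ _ _ c _ hr hh ↦ (hHC (isSmoothProjective_surfaceProduct m)).2 2 c hr hh

section Inhabited

/-- `β₇ = (1, 1, 2, 3)`: a K3-TYPE character of the Fermat surface of degree `7` — its unit orbit
has `6 = φ(7)` elements, exactly one of them (`β₇` itself) with `Σ⟨·⟩ = 7` (`V[β₇] ⊂ H²(S₇, ℚ)`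
has rank `6` and `h²·⁰ = 1`). [cite: Shioda1979HodgeFermat, §1] -/
def β₇ : Fin 4 → ZMod 7 := ![1, 1, 2, 3]

/-- `γ₇ = (6, 6, 5, 4) = -β₇ ∘ (id)`, the partner with `(β₇)₃ + (γ₇)₃ = 0`. [folklore] -/
def γ₇ : Fin 4 → ZMod 7 := ![6, 6, 5, 4]

/-- `α₇ = β₇ # γ₇ = (1, 1, 2, 6, 6, 5)`, a Hodge character of `X⁴₇` in the realisable K3 sector
(it is PAIRED, `(1,6)(1,6)(2,5)`, hence algebraic by linear subspaces — Shioda/Ran; the first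
instances where the K3 engine is load-bearing are `m = 33, 99`). [cite: daSilva2021HodgeFermat, Prop. 3.6] -/
def α₇ : Fin (2 * 2 + 2) → ZMod 7 := ![1, 1, 2, 6, 6, 5]

/-- `α₇` is a Hodge character of `X⁴₇`. [folklore] -/
theorem isHodge_α₇ : FermatCharacter.IsHodge α₇ := by
  unfold α₇ FermatCharacter.IsHodge FermatCharacter.IsAdmissible FermatCharacter.normSum
  decide

/-- `β₇` is K3-type. [folklore] -/
theorem isK3Type_β₇ : IsK3Type β₇ := by
  refine ⟨β₇, ⟨⟨1, by simp⟩, by unfold β₇ FermatCharacter.normSum; decide⟩, ?_⟩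
  rintro δ ⟨⟨t, rfl⟩, hδ⟩
  revert t
  unfold β₇ FermatCharacter.normSum
  decide

/-- `β₇` has K3-realisable rank (orbit size `6 ≤ 21`). [folklore] -/
theorem hasK3Rank_β₇ : HasK3Rank β₇ :=
  ⟨Finset.univ.image (fun t : (ZMod 7)ˣ ↦ fun i ↦ (t : ZMod 7) * β₇ i),
    Finset.card_image_le.trans (by rw [Finset.card_univ, ZMod.card_units_eq_totient]; decide),
    fun t ↦ Finset.mem_image_of_mem _ (Finset.mem_univ t)⟩

/-- **The realisable K3 sector is inhabited in kind (BC5-style sanity, PROVED)**: at `m = 7` the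
Hodge character `α₇ = (1,1,2,6,6,5)` of `X⁴₇` satisfies the crux's hypothesis with the K3-type split
`β₇ # γ₇` — the definitions compute. (Its conclusion there is Shioda's paired case, not proved here.)
[cite: Shioda1979HodgeFermat, §1] -/
theorem k3Sector_hypothesis_inhabited :
    FermatCharacter.IsHodge α₇ ∧ ∃ β γ : Fin 4 → ZMod 7,
      ((∀ i, β i ≠ 0) ∧ ∑ i, β i = 0 ∧ IsK3Type β) ∧ HasK3Rank β ∧ β 3 + γ 3 = 0 ∧
        univ.val.map α₇ = ({β 0, β 1, β 2} + {γ 0, γ 1, γ 2} : Multiset (ZMod 7)) :=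
  ⟨isHodge_α₇, β₇, γ₇, ⟨by unfold β₇; decide, by unfold β₇; decide, isK3Type_β₇⟩, hasK3Rank_β₇,
    by unfold β₇ γ₇; decide, by unfold α₇ β₇ γ₇; decide⟩

end Inhabited

/-! ### The composition: stub₁ → stub₂ → stub₃ → the crux, by name -/

/-- **THE LINE'S COMPOSITION** (kernel-checked, no `sorry`): the type-I transfer (STUB 1), the Hodge
structure of the pair block (STUB 2) and the K3 engine on `Sₘ × Sₘ` (STUB 3) imply the crux
`K3SectorAlgebraic`. Given a Hodge `α` with a realisable-K3 split `β # γ`: `γ` is admissible and the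
pair `(β, γ)` is Hodge (`gamma_ne_zero`, `gamma_sum_eq_zero`, `pairHodge_of_split`); by STUB 2 the
line `W(β, γ)` is spanned by rational `(2,2)` classes of the block, each algebraic by STUB 3, so
`W(β, γ) ⊆ algebraicClasses (Sₘ × Sₘ) 2`; STUB 1 transfers this to `V(α) ⊆ algebraicClasses X⁴ₘ 2`,
and the crux's inline eigenvector predicate is `c ∈ V(α)` (`memPred_iff`). [folklore] -/
theorem K3SectorAlgebraic_of :
    (∀ (m : ℕ) [NeZero m] (β γ : Fin 4 → ZMod m) (α : Fin (2 * 2 + 2) → ZMod m),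
      (∀ i, β i ≠ 0) → ∑ i, β i = 0 → (∀ j, γ j ≠ 0) → ∑ j, γ j = 0 → β 3 + γ 3 = 0 →
      FermatCharacter.IsHodge α →
      univ.val.map α = ({β 0, β 1, β 2} + {γ 0, γ 1, γ 2} : Multiset (ZMod m)) →
      pairEigenspace m β γ ≤ algebraicClasses (fermatSurface m ⊗ fermatSurface m) 2 →
      fermatEigenspace m α (2 * 2) ≤ algebraicClasses (fermatFourfold m) 2) →
    (∀ (m : ℕ) [NeZero m] (β γ : Fin 4 → ZMod m),
      (∀ i, β i ≠ 0) → ∑ i, β i = 0 → (∀ j, γ j ≠ 0) → ∑ j, γ j = 0 →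
      (∀ t : (ZMod m)ˣ, FermatCharacter.normSum (fun i ↦ (t : ZMod m) * β i) +
        FermatCharacter.normSum (fun i ↦ (t : ZMod m) * γ i) = m * 4) →
      pairEigenspace m β γ ≤ Submodule.span ℂ
        {c | IsRationalClass c ∧ IsOfHodgeType 4 (fermatSurface m ⊗ fermatSurface m) (2 * 2) 2 2 c ∧
          c ∈ pairBlock m β γ}) →
    (∀ (m : ℕ) [NeZero m] (β γ : Fin 4 → ZMod m),
      (∀ i, β i ≠ 0) → ∑ i, β i = 0 → IsK3Type β → HasK3Rank β →
      (∀ j, γ j ≠ 0) → ∑ j, γ j = 0 → β 3 + γ 3 = 0 →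
      ∀ c ∈ pairBlock m β γ, IsRationalClass c →
        IsOfHodgeType 4 (fermatSurface m ⊗ fermatSurface m) (2 * 2) 2 2 c →
        c ∈ algebraicClasses (fermatSurface m ⊗ fermatSurface m) 2) →
    K3SectorAlgebraic := by
  intro hT hH hK m _ α hα hsplit c hc
  obtain ⟨β, γ, ⟨hβ0, hβs, hK3⟩, hO, h3, hαβγ⟩ := hsplit
  have hγ0 : ∀ j, γ j ≠ 0 := gamma_ne_zero hα hβ0 h3 hαβγ
  have hγs : ∑ j, γ j = 0 := gamma_sum_eq_zero hα hβs h3 hαβγ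
  have hW : pairEigenspace m β γ ≤ algebraicClasses (fermatSurface m ⊗ fermatSurface m) 2 := by
    refine (hH m β γ hβ0 hβs hγ0 hγs (pairHodge_of_split hα hβ0 h3 hαβγ)).trans ?_
    rw [Submodule.span_le]
    rintro c' ⟨hr, hh, hb⟩
    exact hK m β γ hβ0 hβs hK3 hO hγ0 hγs h3 c' hb hr hh
  exact hT m β γ α hβ0 hβs hγ0 hγs h3 hα hαβγ hW (memPred_iff.mp hc)

/-- **The crux, closed modulo exactly the three registered stubs.** [folklore] -/
theorem K3SectorAlgebraic_of_stubs : K3SectorAlgebraic :=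
  K3SectorAlgebraic_of stub_typeI_transfer stub_pairBlock_hodge stub_k3Engine_surfaceProduct

end Summit.HodgeConjecture.HodgeConjecture.Cruxes.K3SectorAlgebraic.Birth

end
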